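import Literature.NumberTheory.AdelicBaseChange.CyclotomicCompletionProofs
import Mathlib.NumberTheory.Cyclotomic.PrimitiveRoots
import HarnessLib

/-!
# Completions in a tower `K ⊆ F ⊆ L` of number fields, and the unramified subfield of `ℚ(ζ_{pm′})_w`

`Proofs` file (theorems only — no definition, no instance, no named fact) in topic
`NumberTheory/AdelicBaseChange`, continuing `CompletionBaseChange` (the vendored FLT packet: for
`w ∣ u` the `F_u`-algebra structure `Extension.adicCompletionSemialgHom F L w` on `L_w`, and the local
base change `L ⊗[F] F_u ≃ ∏_{w ∣ u} L_w`, Cassels–Fröhlich II §10 (10.2)) and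
`CyclotomicCompletionProofs` (`ℚ(ζ_m)_w / ℚ_v` is cyclotomic, Galois, unramified for `p ∤ m`).

## §1 Towers (any number fields `K ⊆ F ⊆ L`, places `w ∣ u ∣ v`)
For `u : v.Extension (𝓞 F)`, `w : v.Extension (𝓞 L)` with `w ∩ 𝓞 F = u`, write
`ι = Extension.adicCompletionSemialgHom F L ⟨w, _⟩ : F_u → L_w` for the packet's local map.
* `adicCompletionSemialgHom_algebraMap` — **`ι ∘ (K_v → F_u) = (K_v → L_w)`**: the three local
  maps of the packet form a commuting triangle (both sides are continuous and agree on the dense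
  image of `K`; Cassels–Fröhlich II §10, uniqueness of the canonical map `k_v → K_w`).
* `exists_trace_adicCompletionSemialgHom_eq_nsmul` — **`Tr_{L_w/K_v}(ι x) = n · Tr_{F_u/K_v}(x)`**
  with `n = [L_w : F_u]`, `n · [F_u : K_v] = [L_w : K_v]` and **`n ≤ [L : F]`** (the local degree is
  at most the global degree: `L_w` is a direct factor of `L ⊗[F] F_u`; Cassels–Fröhlich II §11,
  `Σ_{w ∣ u} n_w = n`).
* `valued_adicCompletionSemialgHom_le_one_iff` / `…_lt_one_iff` — `ι` preserves and reflects
  integrality and the maximal ideal (`v_w(ι x) = v_u(x)^{e(w∣u)}`, packet).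

## §2 The unramified subfield at `p` of `ℚ(ζ_{p m′})`, `p ∤ m′`
For `L` with `IsCyclotomicExtension {p * m′} ℚ L` and a subfield `F ⊆ L` with
`IsCyclotomicExtension {m′} ℚ F` (e.g. `F = ℚ(ζ^p)`, `exists_intermediateField_isCyclotomicExtension`):
* `finrank_eq_sub_one_of_isCyclotomicExtension` — **`[L : F] = p − 1`** (`φ(pm′) = (p−1)φ(m′)`,
  Neukirch I (10.2));
* `exists_trace_adicCompletionSemialgHom_eq_nsmul_not_dvd` — at every `w ∣ p` of `L`, with
  `u = w ∩ 𝓞 F`: **`Tr_{L_w/ℚ_v}(ι x) = n · Tr_{F_u/ℚ_v}(x)` with `p ∤ n`** (`1 ≤ n ≤ p − 1`);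
  and `F_u / ℚ_v` is unramified and Galois by `CyclotomicCompletionProofs` applied to `F`
  (`valued_le_valued_natCast_of_lt_one_extension`, `isGalois_adicCompletion`) — `F_u` is the maximal
  unramified subextension of `L_w / ℚ_p` (Neukirch II (7.12)–(7.13) and the remark after (7.13)).

Motivation (cell `bsd-addord`, crux `KatoKuriharaPortThreeShared`, stub `hKloc`/`hLog` clause (d) at
the levels `m = 3·m′`, decision (R-b) of the crux LEAD 2026-08-27): the unit-trace logarithm point of
the K-port consumer is produced over the UNRAMIFIED field `F_u = ℚ₃(ζ_{m′})_u` and pushed into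
`L_w = ℚ₃(ζ_{3m′})_w` along `ι`; `p ∤ n` keeps the trace a unit.  Nothing here is specific to
elliptic curves.

## References
* [CasselsFrohlichANT1967] J. W. S. Cassels, A. Fröhlich (eds.), *Algebraic Number Theory* (1967),
  Ch. II (Cassels) §10 (10.2) and §11.
* [NeukirchANT1999] J. Neukirch, *Algebraic Number Theory* (1999), Ch. I (10.2); Ch. II (7.12)–(7.13)
  and §8 p. 161.
* [FLTProject2025] the FLT project, `FLT/DedekindDomain/Completion/BaseChange.lean` (vendored packet).

## Design
Theorems only (plumbing `private`); the place of `F` below `w` enters through the hypothesis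
`h : w.1.under (𝓞 F) = u.1` (so that both packet instances `Algebra ℚ_v F_u`, `Algebra ℚ_v L_w` are
found by unification), and `ι` is the packet's `Extension.adicCompletionSemialgHom F L ⟨w.1, h⟩`;
the degree `n = [L_w : F_u]` is delivered existentially with its two characterising (in)equalities,
so no `Algebra F_u L_w` instance needs registering.  `noncomputable section`; axioms standard.
-/

noncomputable section

open scoped NumberField
open IsDedekindDomain NumberField

namespace Literature.NumberTheory.AdelicBaseChange

/-! ## §1 Towers of completions -/

section Tower

variable (K F L : Type*) [Field K] [NumberField K] [Field F] [NumberField F] [Field L] [NumberField L]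
  [Algebra K F] [Algebra F L] [Algebra K L] [IsScalarTower K F L]
variable (v : HeightOneSpectrum (𝓞 K)) (u : v.Extension (𝓞 F)) (w : v.Extension (𝓞 L))
  (h : w.1.under (𝓞 F) = u.1)

omit [NumberField K] [NumberField F] [NumberField L] in
/-- A place of `L` above the place `u` of `F` above `v` lies above `v`: `(w ∩ 𝓞 F) ∩ 𝓞 K = w ∩ 𝓞 K`.
[cite: CasselsFrohlichANT1967, Ch. II §10] -/
theorem under_under_ringOfIntegers (w : HeightOneSpectrum (𝓞 L)) :
    (w.under (𝓞 F)).under (𝓞 K) = w.under (𝓞 K) := by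
  ext1
  simp [HeightOneSpectrum.under_asIdeal, Ideal.under_under]

/-- **The local maps commute: `ι ∘ (K_v → F_u) = (K_v → L_w)`** for `w ∣ u ∣ v`, `ι : F_u → L_w` the
packet's map — both sides are continuous `K_v → L_w` and agree on the dense image of `K`.
[cite: CasselsFrohlichANT1967, Ch. II §10 (canonical map k_v → K_w)] -/
theorem adicCompletionSemialgHom_algebraMap (x : v.adicCompletion K) :
    HeightOneSpectrum.Extension.adicCompletionSemialgHom F L (⟨w.1, h⟩ : u.1.Extension (𝓞 L))
        (algebraMap (v.adicCompletion K) (u.1.adicCompletion F) x) =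
      algebraMap (v.adicCompletion K) (w.1.adicCompletion L) x := by
  set wF : u.1.Extension (𝓞 L) := ⟨w.1, h⟩ with hwF
  have key : (fun x : v.adicCompletion K ↦
      HeightOneSpectrum.Extension.adicCompletionSemialgHom F L wF
        (algebraMap (v.adicCompletion K) (u.1.adicCompletion F) x)) =
      fun x ↦ algebraMap (v.adicCompletion K) (w.1.adicCompletion L) x := by
    refine (HeightOneSpectrum.denseRange_algebraMap (K := K) v).equalizer ?_ ?_ ?_
    · exact (HeightOneSpectrum.Extension.adicCompletionSemialgHom_continuous F L wF).comp
        (HeightOneSpectrum.Extension.adicCompletionSemialgHom_continuous K F u)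
    · exact HeightOneSpectrum.Extension.adicCompletionSemialgHom_continuous K L w
    · funext k
      simp only [Function.comp_apply]
      have e1 : algebraMap (v.adicCompletion K) (u.1.adicCompletion F)
          (algebraMap K (v.adicCompletion K) k) =
          algebraMap F (u.1.adicCompletion F) (algebraMap K F k) :=
        HeightOneSpectrum.Extension.adicCompletionSemialgHom_coe K F u (WithVal.toVal _ k)
      have e2 : HeightOneSpectrum.Extension.adicCompletionSemialgHom F L wF
          (algebraMap F (u.1.adicCompletion F) (algebraMap K F k)) =
          algebraMap L (w.1.adicCompletion L) (algebraMap F L (algebraMap K F k)) :=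
        HeightOneSpectrum.Extension.adicCompletionSemialgHom_coe F L wF (WithVal.toVal _ (algebraMap K F k))
      have e3 : algebraMap (v.adicCompletion K) (w.1.adicCompletion L)
          (algebraMap K (v.adicCompletion K) k) =
          algebraMap L (w.1.adicCompletion L) (algebraMap K L k) :=
        HeightOneSpectrum.Extension.adicCompletionSemialgHom_coe K L w (WithVal.toVal _ k)
      rw [e1, e2, e3, ← IsScalarTower.algebraMap_apply K F L]
  exact congrFun key x

omit [IsScalarTower K F L] in
/-- **`ι` preserves and reflects integrality:** `v_w(ι x) ≤ 1 ↔ v_u(x) ≤ 1`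
(`v_w ∘ ι = v_u ^ {e(w ∣ u)}` with `e ≠ 0`). [cite: CasselsFrohlichANT1967, Ch. II §10] -/
theorem valued_adicCompletionSemialgHom_le_one_iff (x : u.1.adicCompletion F) :
    Valued.v (HeightOneSpectrum.Extension.adicCompletionSemialgHom F L
        (⟨w.1, h⟩ : u.1.Extension (𝓞 L)) x) ≤ 1 ↔ Valued.v x ≤ 1 := by
  rw [HeightOneSpectrum.Extension.valued_adicCompletionSemialgHom]
  exact pow_le_one_iff (HeightOneSpectrum.ramificationIdx_ne_zero (𝓞 F) (𝓞 L)
    (algebraMap_injective_of_field_isFractionRing (𝓞 F) (𝓞 L) F L) w.1)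

omit [IsScalarTower K F L] in
/-- **`ι` preserves and reflects the maximal ideal:** `v_w(ι x) < 1 ↔ v_u(x) < 1`.
[cite: CasselsFrohlichANT1967, Ch. II §10] -/
theorem valued_adicCompletionSemialgHom_lt_one_iff (x : u.1.adicCompletion F) :
    Valued.v (HeightOneSpectrum.Extension.adicCompletionSemialgHom F L
        (⟨w.1, h⟩ : u.1.Extension (𝓞 L)) x) < 1 ↔ Valued.v x < 1 := by
  rw [HeightOneSpectrum.Extension.valued_adicCompletionSemialgHom]
  exact pow_lt_one_iff (HeightOneSpectrum.ramificationIdx_ne_zero (𝓞 F) (𝓞 L)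
    (algebraMap_injective_of_field_isFractionRing (𝓞 F) (𝓞 L) F L) w.1)

omit [Algebra K L] [IsScalarTower K F L] in
open scoped TensorProduct.RightActions in
/-- The local degree is at most the global degree: `[L_w : F_u] ≤ [L : F]` (`L_w` is a direct
factor of `L ⊗[F] F_u ≅ ∏_{w' ∣ u} L_{w'}`). [cite: CasselsFrohlichANT1967, Ch. II §11] -/
private theorem finrank_adicCompletion_le (w' : u.1.Extension (𝓞 L)) :
    Module.finrank (u.1.adicCompletion F) (w'.1.adicCompletion L) ≤ Module.finrank F L := by
  letI := HeightOneSpectrum.Extension.fintype (𝓞 F) F L (𝓞 L) u.1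
  have h1 : Module.finrank (u.1.adicCompletion F)
      (Π w'' : u.1.Extension (𝓞 L), w''.1.adicCompletion L) = Module.finrank F L := by
    rw [← HeightOneSpectrum.adicCompletion.finrank_tensorProduct_adicCompletion_eq_finrank_pi_adicCompletion
      F L (𝓞 L) u.1, TensorProduct.finrank_rightAlgebra]
  rw [← h1, Module.finrank_pi_fintype]
  exact Finset.single_le_sum (f := fun w'' : u.1.Extension (𝓞 L) ↦
      Module.finrank (u.1.adicCompletion F) (w''.1.adicCompletion L)) (fun _ _ ↦ Nat.zero_le _)
    (Finset.mem_univ w')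

/-- **Traces in the tower of completions.** For `w ∣ u ∣ v` and `ι : F_u → L_w` the packet's map
there is `n` (`= [L_w : F_u]`) with `n · [F_u : K_v] = [L_w : K_v]`, `n ≤ [L : F]`, and
**`Tr_{L_w/K_v}(ι x) = n · Tr_{F_u/K_v}(x)`** for all `x : F_u`.
[cite: CasselsFrohlichANT1967, Ch. II §10–§11] -/
theorem exists_trace_adicCompletionSemialgHom_eq_nsmul :
    ∃ n : ℕ, n * Module.finrank (v.adicCompletion K) (u.1.adicCompletion F) =
        Module.finrank (v.adicCompletion K) (w.1.adicCompletion L) ∧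
      n ≤ Module.finrank F L ∧
      ∀ x : u.1.adicCompletion F,
        Algebra.trace (v.adicCompletion K) (w.1.adicCompletion L)
          (HeightOneSpectrum.Extension.adicCompletionSemialgHom F L
            (⟨w.1, h⟩ : u.1.Extension (𝓞 L)) x) =
        n • Algebra.trace (v.adicCompletion K) (u.1.adicCompletion F) x := by
  set wF : u.1.Extension (𝓞 L) := ⟨w.1, h⟩ with hwF
  -- the packet's `F_u`-algebra structure on `L_w = L_{wF}`
  letI : Algebra (u.1.adicCompletion F) (w.1.adicCompletion L) :=
    inferInstanceAs (Algebra (u.1.adicCompletion F) (wF.1.adicCompletion L))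
  haveI : Module.Finite (u.1.adicCompletion F) (w.1.adicCompletion L) :=
    inferInstanceAs (Module.Finite (u.1.adicCompletion F) (wF.1.adicCompletion L))
  haveI : IsScalarTower (v.adicCompletion K) (u.1.adicCompletion F) (w.1.adicCompletion L) :=
    IsScalarTower.of_algebraMap_eq fun x ↦
      (adicCompletionSemialgHom_algebraMap K F L v u w h x).symm
  refine ⟨Module.finrank (u.1.adicCompletion F) (w.1.adicCompletion L), ?_, ?_, fun x ↦ ?_⟩
  · rw [mul_comm]
    exact Module.finrank_mul_finrank (v.adicCompletion K) (u.1.adicCompletion F)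
      (w.1.adicCompletion L)
  · exact finrank_adicCompletion_le K F L v u wF
  · change Algebra.trace (v.adicCompletion K) (w.1.adicCompletion L)
        (algebraMap (u.1.adicCompletion F) (w.1.adicCompletion L) x) = _
    rw [← Algebra.trace_trace (S := u.1.adicCompletion F), Algebra.trace_algebraMap, map_nsmul]

end Tower

/-! ## §2 The unramified subfield of `ℚ(ζ_{p m′})_w`, `p ∤ m′` -/

section Cyclotomic

variable (L : Type*) [Field L] [NumberField L] (p m' : ℕ) [hp : Fact p.Prime] [NeZero m']

/-- `p · m′ ≠ 0`. [folklore] -/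
private theorem neZero_mul : NeZero (p * m') := ⟨Nat.mul_ne_zero hp.out.ne_zero (NeZero.ne m')⟩

/-- **The subfield `ℚ(ζ^p) ⊆ ℚ(ζ_{pm′})` is `ℚ(μ_{m′})`:** for `L` with `IsCyclotomicExtension {p·m′} ℚ L`
there is an intermediate field `F` with `IsCyclotomicExtension {m′} ℚ F` (namely `ℚ(ζ_{pm′}^p)`).
[cite: NeukirchANT1999, Ch. I (10.2)] -/
theorem exists_intermediateField_isCyclotomicExtension
    [hL : haveI := neZero_mul p m'; IsCyclotomicExtension {p * m'} ℚ L] :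
    ∃ F : IntermediateField ℚ L, IsCyclotomicExtension {m'} ℚ F := by
  haveI := neZero_mul p m'
  have hζ := IsCyclotomicExtension.zeta_spec (p * m') ℚ L
  have hζp : IsPrimitiveRoot (IsCyclotomicExtension.zeta (p * m') ℚ L ^ p) m' := by
    have h := hζ.pow_of_dvd hp.out.ne_zero (Dvd.intro m' rfl)
    rwa [Nat.mul_div_cancel_left m' hp.out.pos] at h
  exact ⟨IntermediateField.adjoin ℚ {IsCyclotomicExtension.zeta (p * m') ℚ L ^ p},
    hζp.intermediateField_adjoin_isCyclotomicExtension ℚ⟩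

variable (F : Type*) [Field F] [NumberField F] [Algebra F L] [IsScalarTower ℚ F L]

/-- **`[ℚ(ζ_{pm′}) : ℚ(ζ_{m′})] = p − 1`** for `p ∤ m′` (`φ(pm′) = (p−1)·φ(m′)` and
`[ℚ(ζ_n) : ℚ] = φ(n)`). [cite: NeukirchANT1999, Ch. I (10.2)] -/
theorem finrank_eq_sub_one_of_isCyclotomicExtension (hm : ¬ p ∣ m')
    [hL : haveI := neZero_mul p m'; IsCyclotomicExtension {p * m'} ℚ L]
    [hF : IsCyclotomicExtension {m'} ℚ F] : Module.finrank F L = p - 1 := by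
  haveI := neZero_mul p m'
  have h1 : Module.finrank ℚ L = (p * m').totient :=
    IsCyclotomicExtension.finrank L (Polynomial.cyclotomic.irreducible_rat (NeZero.pos (p * m')))
  have h2 : Module.finrank ℚ F = m'.totient :=
    IsCyclotomicExtension.finrank F (Polynomial.cyclotomic.irreducible_rat (NeZero.pos m'))
  have h3 := Module.finrank_mul_finrank ℚ F L
  rw [h1, h2, Nat.totient_mul_of_prime_of_not_dvd hp.out hm, mul_comm (p - 1)] at h3
  exact Nat.eq_of_mul_eq_mul_left (Nat.totient_pos.mpr (NeZero.pos m')) h3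

/-- **The unramified-subfield transfer of traces, with a `p`-adic unit multiplier.** Let
`p ∤ m′`, `L ⊇ F` number fields with `IsCyclotomicExtension {p·m′} ℚ L`, `IsCyclotomicExtension {m′} ℚ F`,
`w ∣ u ∣ v` places with `w ∩ 𝓞 F = u`, and `ι : F_u → L_w` the packet's map.  Then there is `n`
with **`p ∤ n`** and **`Tr_{L_w/ℚ_v}(ι x) = n · Tr_{F_u/ℚ_v}(x)`** for all `x` (`1 ≤ n = [L_w : F_u]
≤ [L : F] = p − 1`).  With `CyclotomicCompletionProofs` (`F_u / ℚ_v` unramified and Galois) this is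
the field-theoretic input for reading a unit-trace element of `L_w` off its unramified subfield.
[cite: NeukirchANT1999, Ch. II (7.12)–(7.13); CasselsFrohlichANT1967, Ch. II §10–§11] -/
theorem exists_trace_adicCompletionSemialgHom_eq_nsmul_not_dvd (hm : ¬ p ∣ m')
    [hL : haveI := neZero_mul p m'; IsCyclotomicExtension {p * m'} ℚ L]
    [hF : IsCyclotomicExtension {m'} ℚ F]
    (v : HeightOneSpectrum (𝓞 ℚ)) (u : v.Extension (𝓞 F)) (w : v.Extension (𝓞 L))
    (h : w.1.under (𝓞 F) = u.1) :
    ∃ n : ℕ, ¬ p ∣ n ∧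
      ∀ x : u.1.adicCompletion F,
        Algebra.trace (v.adicCompletion ℚ) (w.1.adicCompletion L)
          (HeightOneSpectrum.Extension.adicCompletionSemialgHom F L
            (⟨w.1, h⟩ : u.1.Extension (𝓞 L)) x) =
        n • Algebra.trace (v.adicCompletion ℚ) (u.1.adicCompletion F) x := by
  obtain ⟨n, hn, hle, htr⟩ := exists_trace_adicCompletionSemialgHom_eq_nsmul ℚ F L v u w h
  refine ⟨n, ?_, htr⟩
  rw [finrank_eq_sub_one_of_isCyclotomicExtension L p m' F hm] at hle
  have hpos : 0 < n := by
    rcases Nat.eq_zero_or_pos n with h0 | h0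
    · exfalso
      rw [h0, zero_mul] at hn
      exact (Module.finrank_pos (R := v.adicCompletion ℚ) (M := w.1.adicCompletion L)).ne' hn.symm
    · exact h0
  exact Nat.not_dvd_of_pos_of_lt hpos (lt_of_le_of_lt hle (Nat.sub_lt hp.out.pos Nat.one_pos))

end Cyclotomic

end Literature.NumberTheory.AdelicBaseChange

end
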